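import Summits.AnomalousDissipation.AnomalousDissipation.Theorems.SolenoidalFractalHomogenisationLagrangianStepVmodSSReduce
import Summits.AnomalousDissipation.AnomalousDissipation.Theorems.SolenoidalFractalHomogenisationLagrangianStepOneLevelSplitDefsH
import HarnessLib

/-!
# K1L_D (stmt-AnomalousDissipation-27980): (V_mod) FLAT STAGE — the (ℓ2) TEXTS WITH THE W7 BINDER THREADED («EH twins», definitions only)
(line file of the (V_mod) lane; prover lead-k1l-onelevel-p1 g6 = pen of the EH twins, tenure RULINGS D27-9 / D27-9′ (1); the block architecture of prover
ad-sawtooth-k1loc-p1 g14 — `…VmodFlatBlocks` p705511, `…VmodFlatBlocksE` p706403, `…VmodSSReduce` p707653, `…VmodConstMode` — is untouched.)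

RULING D27-9 (certifier planner ad-ideate-p5 g14, finding F-p5g14-2, regime table `Cruxes/…/Lines/onelevel-ss-regimes.md` v2 a12946c2471d; 3-probe on
`SSMode_textE` 2026-08-29T07:59:23Z: SHAPE PASS, derivability from (V) alone FAILS): on the shell Bloch classes `g₀·n/⌈K/ν⌉ < ‖ℓ‖ ≤ n/4` the (ss) block needs a
ν-uniform decay of the true member that (V) does not give; the input is the §9z text's own W7 high-label-decay family
`(∀ Kb : ℝ, 1 ≤ Kb → ∃ CK : ℝ, 1 ≤ CK ∧ ∃ cK > (0:ℝ), ∃ νh > (0:ℝ), HighLabelDecayW W M hM lo hi Λ β νh Kb CK cK)`.  D27-9′ (1): THREAD THE BINDER (no sixth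
block): each text below is its `…E` twin with that family inserted VERBATIM as an antecedent after `SlowVectorClauseF …`; (sf)/(fs)/(ff) (`Bsf_textE`,
`Bfs_textE`, `Bff_textE`) are unchanged (they consume neither (V) nor W7).
* `SSMode_textEH e` — the single-real-mode-pair target (successor prover ad-sawtooth-k1loc-p1 g15; label split at `L := g₀·n/⌈K/ν⌉` INSIDE the proof,
  `Kb := (K+1)/g₀`, rows C/H/M of the table);
* `BssNZ_textEH e`, `Bss_textEH e` — the (ss) block on nonzero slow / all slow data;
* `lossFlatW_of_V_textEH e` — the flat-stage output (= what the (ℓ3) modulated stage consumes under v25 `stub_Vmod_of_VRH` / v26 `stub_Vmod_E`).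
Theorems threading the binder through the landed reductions: `…VmodFlatBlocksEH` (`lossFlatW_of_blocksEH`), `…VmodSSReduceH` (`bssNZ_of_ssModeH`,
`bss_of_bssNZH`, `bss_of_ssModeH`).  Definitions only; NOT a proof of anything; K1L_D open; AD NOT proved; rung F-D1.A0.
-/

set_option linter.dupNamespace false

noncomputable section

namespace Summit.AnomalousDissipation.AnomalousDissipation.Theorems.SolenoidalFractalHomogenisation.LagrangianStep.VmodFlat

open Literature.Analysis Literature.Analysis.FluidPDE Literature.Analysis.FunctionSpaces
open MeasureTheory Set Filter UnitAddTorus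
open scoped ENNReal NNReal InnerProductSpace
open Summit.AnomalousDissipation.AnomalousDissipation.Theorems.SolenoidalFractalHomogenisation.LagrangianStep.CellClauseMod

/-! ## §1 The single-pair target and the (ss) block texts, W7 binder threaded -/

/-- **(ss-mode) THE SINGLE-PAIR TARGET with the W7 binder** at output exponent `e σ` (D27-9′ twin of `SSMode_textE`; certifier 3-probe 07:59:23Z: SHAPE PASS,
derivability from (V) alone FAILS on the shell classes ⇒ this binder; the label split at `L := g₀·n/⌈K/ν⌉` lives INSIDE the proof, `Kb := (K+1)/g₀`). -/
def SSMode_textEH (e : ℝ → ℝ) : Prop := ∀ k (W : LatticeShear.LatticeWord k) (M : ℝ) (hM : 0 < M) (c : ℝ), 0 < c →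
  ∀ (Φ : ℝ → Torus.Visc4 (Fin 3) → Torus.Visc4 (Fin 3)) (lo hi Λ β σ C ν₀ K : ℝ),
    0 < lo → lo ≤ 1 → 1 ≤ hi → 1 < Λ → 0 ≤ β → 0 < σ → 0 ≤ C → 0 < ν₀ → ν₀ ≤ 1 → 0 < K →
    SlowVectorClauseF W M hM c Φ lo hi Λ β σ C ν₀ K →
    (∀ Kb : ℝ, 1 ≤ Kb → ∃ CK : ℝ, 1 ≤ CK ∧ ∃ cK > (0:ℝ), ∃ νh > (0:ℝ), HighLabelDecayW W M hM lo hi Λ β νh Kb CK cK) →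
    ∃ C₁ : ℝ, C ≤ C₁ ∧
    ∀ ν, ∀ hν : ν ∈ Set.Ioo 0 ν₀, ∀ n : ℕ, (⌈K / ν⌉₊ : ℝ) ≤ n → ∀ 𝔸 : Torus.Visc4 (Fin 3),
      Torus.OddSmall 𝔸 (ν * β) → (∃ lam ∈ Set.Icc (1:ℝ) Λ, Torus.NearIso 𝔸 (ν * (lo / lam)) (ν * (hi * lam))) →
      Torus.OddSmall (Φ ν ((1 / ν) • 𝔸)) β → (∃ lam ∈ Set.Icc (1:ℝ) Λ, Torus.NearIso (Φ ν ((1 / ν) • 𝔸)) (lo / lam) (hi * lam)) →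
      ∀ Tw > (0:ℝ), ∀ U T : ℝ → ℝ → (V2 →L[ℝ] V2),
        Torus.IsPropagator Tw (cellField W M hM ν hν.1 n) ((1 / (n:ℝ) ^ 2) • 𝔸) U →
        Torus.IsPropagator Tw (fun _ _ => 0) ((1 / (n:ℝ) ^ 2) • (𝔸 + (c / ν) • Φ ν ((1 / ν) • 𝔸))) T →
      ∀ s t : ℝ, 0 ≤ s → s < t → t ≤ Tw →
      ∀ ℓ ∈ (Torus.freqBall (d := Fin 3) (n / 4)).erase 0, ∀ v : V2, v ∈ Torus.divFreeL2 (Fin 3) →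
        (∀ k', k' ≠ ℓ → k' ≠ -ℓ → fc v k' = 0) →
        ‖fc (U s t v - T s t v) ℓ‖
          ≤ (C₁ * (C₁ * (ν ^ e σ + ((⌈K / ν⌉₊ : ℝ) / n) ^ e σ) + (min 1 ((M * W.period / ν) / (t - s))) ^ e σ))
            * dW lo Λ c ν n (t - s) ℓ * ‖fc v ℓ‖

/-- (ss) on NONZERO slow data with the W7 binder, output exponent `e σ` (twin of `BssNZ_textE`). -/
def BssNZ_textEH (e : ℝ → ℝ) : Prop := ∀ k (W : LatticeShear.LatticeWord k) (M : ℝ) (hM : 0 < M) (c : ℝ), 0 < c →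
  ∀ (Φ : ℝ → Torus.Visc4 (Fin 3) → Torus.Visc4 (Fin 3)) (lo hi Λ β σ C ν₀ K : ℝ),
    0 < lo → lo ≤ 1 → 1 ≤ hi → 1 < Λ → 0 ≤ β → 0 < σ → 0 ≤ C → 0 < ν₀ → ν₀ ≤ 1 → 0 < K →
    SlowVectorClauseF W M hM c Φ lo hi Λ β σ C ν₀ K →
    (∀ Kb : ℝ, 1 ≤ Kb → ∃ CK : ℝ, 1 ≤ CK ∧ ∃ cK > (0:ℝ), ∃ νh > (0:ℝ), HighLabelDecayW W M hM lo hi Λ β νh Kb CK cK) →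
    ∃ C₁ : ℝ, C ≤ C₁ ∧ BlockBound W M hM c Φ lo hi Λ β (e σ) C₁ ν₀ K IsSlowNZ IsSlowNZ

/-- (ss) at output exponent `e σ`, WITH the W7 high-label-decay family as an antecedent (D27-9′ twin of `Bss_textE`). -/
def Bss_textEH (e : ℝ → ℝ) : Prop := ∀ k (W : LatticeShear.LatticeWord k) (M : ℝ) (hM : 0 < M) (c : ℝ), 0 < c →
  ∀ (Φ : ℝ → Torus.Visc4 (Fin 3) → Torus.Visc4 (Fin 3)) (lo hi Λ β σ C ν₀ K : ℝ),
    0 < lo → lo ≤ 1 → 1 ≤ hi → 1 < Λ → 0 ≤ β → 0 < σ → 0 ≤ C → 0 < ν₀ → ν₀ ≤ 1 → 0 < K →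
    SlowVectorClauseF W M hM c Φ lo hi Λ β σ C ν₀ K →
    (∀ Kb : ℝ, 1 ≤ Kb → ∃ CK : ℝ, 1 ≤ CK ∧ ∃ cK > (0:ℝ), ∃ νh > (0:ℝ), HighLabelDecayW W M hM lo hi Λ β νh Kb CK cK) →
    ∃ C₁ : ℝ, C ≤ C₁ ∧ BlockBound W M hM c Φ lo hi Λ β (e σ) C₁ ν₀ K IsSlow IsSlow

/-! ## §2 The flat-stage output, W7 binder threaded -/

/-- The flat-stage target at output exponent `e σ`, WITH the W7 family as an antecedent (D27-9′ twin of `lossFlatW_of_V_textE`; = (ℓ2)'s output under v25 `stub_Vmod_of_VRH`). -/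
def lossFlatW_of_V_textEH (e : ℝ → ℝ) : Prop := ∀ k (W : LatticeShear.LatticeWord k) (M : ℝ) (hM : 0 < M) (c : ℝ), 0 < c →
  ∀ (Φ : ℝ → Torus.Visc4 (Fin 3) → Torus.Visc4 (Fin 3)) (lo hi Λ β σ C ν₀ K : ℝ),
    0 < lo → lo ≤ 1 → 1 ≤ hi → 1 < Λ → 0 ≤ β → 0 < σ → 0 ≤ C → 0 < ν₀ → ν₀ ≤ 1 → 0 < K →
    SlowVectorClauseF W M hM c Φ lo hi Λ β σ C ν₀ K →
    (∀ Kb : ℝ, 1 ≤ Kb → ∃ CK : ℝ, 1 ≤ CK ∧ ∃ cK > (0:ℝ), ∃ νh > (0:ℝ), HighLabelDecayW W M hM lo hi Λ β νh Kb CK cK) →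
    ∃ Cm : ℝ, C ≤ Cm ∧ SlowVectorClauseLossFlatW W M hM c Φ lo hi Λ β (e σ) Cm ν₀ K


end Summit.AnomalousDissipation.AnomalousDissipation.Theorems.SolenoidalFractalHomogenisation.LagrangianStep.VmodFlat

end
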